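import Mathlib.Tactic.Ring
import Mathlib.Tactic.Linarith
import Mathlib.Data.Real.Basic
import Summits.HodgeConjecture.HodgeConjecture.Theorems.WeilClassTestFormatFourTwoSorted
import HarnessLib

/-!
# CONJECTURE N IN FORMAT (4,2), REAL CHARGES — `conjectureN_42` (hodge-weil ladder, GAPS G51b; part 4/4)

Prover 2, generation 13 (note `run/shared/lean/b2b/hodge-weil/b2b-hweil-pv2-g13/PRODUCT-FORMULA-G13.md`). THEOREM (`conjectureN_42`), in the
coordinates of `CONJECTURE-N.md` §1 (pv2-g9): for every real (4,2) configuration — E-roots `(A_e, u_e)`, `e = 1..4`, F-roots `(B_f, v_f)`, `f = 1,2` —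
that is CENTRED (`ΣA = ΣB`, `Σu = Σv`), PURE (`P1: ΣA²u = ΣB²v`, `P2: ΣAu² = ΣBv²`, `P4: Σu³ = Σv³`) and PAIRWISE AMPLE at scale one
(`|u_e − v_f| ≤ A_e − B_f` for all `e, f`), the charge-0 class-test quantity satisfies
`G₀ = ½S_AS_u + S_Au² − 3S_{A²u²} + 3S_{u⁴} − (3/2)S_u² ≥ 0`.
Equivalently (pv2-g8's scale-free form) `J = Q₂ + ρ_max²Q₄ ≥ 0`: NO pure pairwise-ample corank-one determinantal design of format (4,2) passes the
charge-0 component `(V)₀` of the survival test strictly inside its ample range (door A in format (4,2), every `d`; cf. `SEED-OBSTRUCTION.md` §9,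
`CHARGE-ZERO-LEMMA.md` §6, `CONJECTURE-N.md`, `CROSS-MAX-G10/G11.md`, `VERTEX-FORM-G12.md`). This file only removes the sorting hypothesis of
`conjectureN_42_sorted` (part 3) by the `S₄ × S₂` symmetry of the statement: three insertion steps and the F-swap, each leaf re-instantiating the
previous step with relabelled roots and identifying the two renderings of `G₀` by `ring`. Nothing here is a case of HC, a rung or a door edge (C22);
no statement of Markman's papers is used. New cell result ⇒ Summits/.
-/

set_option linter.dupNamespace false

namespace Summit.HodgeConjecture.HodgeConjecture.WeilClassTestFormatFourTwo

/-- Sorting step: `u₁ ≤ u₂ ≤ u₃`, `v₁ ≤ v₂`, `u₄` arbitrary. -/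
theorem conjectureN_42_sorted3 (A₁ A₂ A₃ A₄ B₁ B₂ u₁ u₂ u₃ u₄ v₁ v₂ : ℝ)
    (hA : A₁ + A₂ + A₃ + A₄ = B₁ + B₂) (hC : u₁ + u₂ + u₃ + u₄ = v₁ + v₂)
    (hP1 : (A₁ ^ 2 * u₁ + A₂ ^ 2 * u₂ + A₃ ^ 2 * u₃ + A₄ ^ 2 * u₄) - (B₁ ^ 2 * v₁ + B₂ ^ 2 * v₂) = 0)
    (hP2 : (A₁ * u₁ ^ 2 + A₂ * u₂ ^ 2 + A₃ * u₃ ^ 2 + A₄ * u₄ ^ 2) - (B₁ * v₁ ^ 2 + B₂ * v₂ ^ 2) = 0)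
    (hP4 : (u₁ ^ 3 + u₂ ^ 3 + u₃ ^ 3 + u₄ ^ 3) - (v₁ ^ 3 + v₂ ^ 3) = 0)
    (m₁₁ : |u₁ - v₁| ≤ A₁ - B₁) (m₂₁ : |u₂ - v₁| ≤ A₂ - B₁) (m₃₁ : |u₃ - v₁| ≤ A₃ - B₁) (m₄₁ : |u₄ - v₁| ≤ A₄ - B₁)
    (m₁₂ : |u₁ - v₂| ≤ A₁ - B₂) (m₂₂ : |u₂ - v₂| ≤ A₂ - B₂) (m₃₂ : |u₃ - v₂| ≤ A₃ - B₂) (m₄₂ : |u₄ - v₂| ≤ A₄ - B₂)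
    (o₁₂ : u₁ ≤ u₂) (o₂₃ : u₂ ≤ u₃) (ov : v₁ ≤ v₂) :
    0 ≤ (1 / 2) * ((A₁ ^ 2 + A₂ ^ 2 + A₃ ^ 2 + A₄ ^ 2) - (B₁ ^ 2 + B₂ ^ 2)) * ((u₁ ^ 2 + u₂ ^ 2 + u₃ ^ 2 + u₄ ^ 2) - (v₁ ^ 2 + v₂ ^ 2))
        + ((A₁ * u₁ + A₂ * u₂ + A₃ * u₃ + A₄ * u₄) - (B₁ * v₁ + B₂ * v₂)) ^ 2
        - 3 * ((A₁ ^ 2 * u₁ ^ 2 + A₂ ^ 2 * u₂ ^ 2 + A₃ ^ 2 * u₃ ^ 2 + A₄ ^ 2 * u₄ ^ 2) - (B₁ ^ 2 * v₁ ^ 2 + B₂ ^ 2 * v₂ ^ 2))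
      + (3 * ((u₁ ^ 4 + u₂ ^ 4 + u₃ ^ 4 + u₄ ^ 4) - (v₁ ^ 4 + v₂ ^ 4)) - (3 / 2) * ((u₁ ^ 2 + u₂ ^ 2 + u₃ ^ 2 + u₄ ^ 2) - (v₁ ^ 2 + v₂ ^ 2)) ^ 2) := by
  rcases le_total u₃ u₄ with o₃ | o₃
  · exact conjectureN_42_sorted A₁ A₂ A₃ A₄ B₁ B₂ u₁ u₂ u₃ u₄ v₁ v₂ hA hC hP1 hP2 hP4
      m₁₁ m₂₁ m₃₁ m₄₁ m₁₂ m₂₂ m₃₂ m₄₂ o₁₂ o₂₃ o₃ ov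
  · rcases le_total u₂ u₄ with o₂ | o₂
    · exact (conjectureN_42_sorted A₁ A₂ A₄ A₃ B₁ B₂ u₁ u₂ u₄ u₃ v₁ v₂
        (by linarith) (by linarith) (by linarith [hP1]) (by linarith [hP2]) (by linarith [hP4])
        m₁₁ m₂₁ m₄₁ m₃₁ m₁₂ m₂₂ m₄₂ m₃₂ o₁₂ o₂ o₃ ov).trans_eq (by ring)
    · rcases le_total u₁ u₄ with o₁ | o₁
      · exact (conjectureN_42_sorted A₁ A₄ A₂ A₃ B₁ B₂ u₁ u₄ u₂ u₃ v₁ v₂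
          (by linarith) (by linarith) (by linarith [hP1]) (by linarith [hP2]) (by linarith [hP4])
          m₁₁ m₄₁ m₂₁ m₃₁ m₁₂ m₄₂ m₂₂ m₃₂ o₁ o₂ o₂₃ ov).trans_eq (by ring)
      · exact (conjectureN_42_sorted A₄ A₁ A₂ A₃ B₁ B₂ u₄ u₁ u₂ u₃ v₁ v₂
          (by linarith) (by linarith) (by linarith [hP1]) (by linarith [hP2]) (by linarith [hP4])
          m₄₁ m₁₁ m₂₁ m₃₁ m₄₂ m₁₂ m₂₂ m₃₂ o₁ o₁₂ o₂₃ ov).trans_eq (by ring)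

/-- Sorting step: `u₁ ≤ u₂`, `v₁ ≤ v₂`, `u₃, u₄` arbitrary. -/
theorem conjectureN_42_sorted2 (A₁ A₂ A₃ A₄ B₁ B₂ u₁ u₂ u₃ u₄ v₁ v₂ : ℝ)
    (hA : A₁ + A₂ + A₃ + A₄ = B₁ + B₂) (hC : u₁ + u₂ + u₃ + u₄ = v₁ + v₂)
    (hP1 : (A₁ ^ 2 * u₁ + A₂ ^ 2 * u₂ + A₃ ^ 2 * u₃ + A₄ ^ 2 * u₄) - (B₁ ^ 2 * v₁ + B₂ ^ 2 * v₂) = 0)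
    (hP2 : (A₁ * u₁ ^ 2 + A₂ * u₂ ^ 2 + A₃ * u₃ ^ 2 + A₄ * u₄ ^ 2) - (B₁ * v₁ ^ 2 + B₂ * v₂ ^ 2) = 0)
    (hP4 : (u₁ ^ 3 + u₂ ^ 3 + u₃ ^ 3 + u₄ ^ 3) - (v₁ ^ 3 + v₂ ^ 3) = 0)
    (m₁₁ : |u₁ - v₁| ≤ A₁ - B₁) (m₂₁ : |u₂ - v₁| ≤ A₂ - B₁) (m₃₁ : |u₃ - v₁| ≤ A₃ - B₁) (m₄₁ : |u₄ - v₁| ≤ A₄ - B₁)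
    (m₁₂ : |u₁ - v₂| ≤ A₁ - B₂) (m₂₂ : |u₂ - v₂| ≤ A₂ - B₂) (m₃₂ : |u₃ - v₂| ≤ A₃ - B₂) (m₄₂ : |u₄ - v₂| ≤ A₄ - B₂)
    (o₁₂ : u₁ ≤ u₂) (ov : v₁ ≤ v₂) :
    0 ≤ (1 / 2) * ((A₁ ^ 2 + A₂ ^ 2 + A₃ ^ 2 + A₄ ^ 2) - (B₁ ^ 2 + B₂ ^ 2)) * ((u₁ ^ 2 + u₂ ^ 2 + u₃ ^ 2 + u₄ ^ 2) - (v₁ ^ 2 + v₂ ^ 2))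
        + ((A₁ * u₁ + A₂ * u₂ + A₃ * u₃ + A₄ * u₄) - (B₁ * v₁ + B₂ * v₂)) ^ 2
        - 3 * ((A₁ ^ 2 * u₁ ^ 2 + A₂ ^ 2 * u₂ ^ 2 + A₃ ^ 2 * u₃ ^ 2 + A₄ ^ 2 * u₄ ^ 2) - (B₁ ^ 2 * v₁ ^ 2 + B₂ ^ 2 * v₂ ^ 2))
      + (3 * ((u₁ ^ 4 + u₂ ^ 4 + u₃ ^ 4 + u₄ ^ 4) - (v₁ ^ 4 + v₂ ^ 4)) - (3 / 2) * ((u₁ ^ 2 + u₂ ^ 2 + u₃ ^ 2 + u₄ ^ 2) - (v₁ ^ 2 + v₂ ^ 2)) ^ 2) := by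
  rcases le_total u₂ u₃ with o₂ | o₂
  · exact conjectureN_42_sorted3 A₁ A₂ A₃ A₄ B₁ B₂ u₁ u₂ u₃ u₄ v₁ v₂ hA hC hP1 hP2 hP4
      m₁₁ m₂₁ m₃₁ m₄₁ m₁₂ m₂₂ m₃₂ m₄₂ o₁₂ o₂ ov
  · rcases le_total u₁ u₃ with o₁ | o₁
    · exact (conjectureN_42_sorted3 A₁ A₃ A₂ A₄ B₁ B₂ u₁ u₃ u₂ u₄ v₁ v₂
        (by linarith) (by linarith) (by linarith [hP1]) (by linarith [hP2]) (by linarith [hP4])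
        m₁₁ m₃₁ m₂₁ m₄₁ m₁₂ m₃₂ m₂₂ m₄₂ o₁ o₂ ov).trans_eq (by ring)
    · exact (conjectureN_42_sorted3 A₃ A₁ A₂ A₄ B₁ B₂ u₃ u₁ u₂ u₄ v₁ v₂
        (by linarith) (by linarith) (by linarith [hP1]) (by linarith [hP2]) (by linarith [hP4])
        m₃₁ m₁₁ m₂₁ m₄₁ m₃₂ m₁₂ m₂₂ m₄₂ o₁ o₁₂ ov).trans_eq (by ring)

/-- Sorting step: `v₁ ≤ v₂`, E-charges arbitrary. -/
theorem conjectureN_42_vsorted (A₁ A₂ A₃ A₄ B₁ B₂ u₁ u₂ u₃ u₄ v₁ v₂ : ℝ)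
    (hA : A₁ + A₂ + A₃ + A₄ = B₁ + B₂) (hC : u₁ + u₂ + u₃ + u₄ = v₁ + v₂)
    (hP1 : (A₁ ^ 2 * u₁ + A₂ ^ 2 * u₂ + A₃ ^ 2 * u₃ + A₄ ^ 2 * u₄) - (B₁ ^ 2 * v₁ + B₂ ^ 2 * v₂) = 0)
    (hP2 : (A₁ * u₁ ^ 2 + A₂ * u₂ ^ 2 + A₃ * u₃ ^ 2 + A₄ * u₄ ^ 2) - (B₁ * v₁ ^ 2 + B₂ * v₂ ^ 2) = 0)
    (hP4 : (u₁ ^ 3 + u₂ ^ 3 + u₃ ^ 3 + u₄ ^ 3) - (v₁ ^ 3 + v₂ ^ 3) = 0)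
    (m₁₁ : |u₁ - v₁| ≤ A₁ - B₁) (m₂₁ : |u₂ - v₁| ≤ A₂ - B₁) (m₃₁ : |u₃ - v₁| ≤ A₃ - B₁) (m₄₁ : |u₄ - v₁| ≤ A₄ - B₁)
    (m₁₂ : |u₁ - v₂| ≤ A₁ - B₂) (m₂₂ : |u₂ - v₂| ≤ A₂ - B₂) (m₃₂ : |u₃ - v₂| ≤ A₃ - B₂) (m₄₂ : |u₄ - v₂| ≤ A₄ - B₂)
    (ov : v₁ ≤ v₂) :
    0 ≤ (1 / 2) * ((A₁ ^ 2 + A₂ ^ 2 + A₃ ^ 2 + A₄ ^ 2) - (B₁ ^ 2 + B₂ ^ 2)) * ((u₁ ^ 2 + u₂ ^ 2 + u₃ ^ 2 + u₄ ^ 2) - (v₁ ^ 2 + v₂ ^ 2))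
        + ((A₁ * u₁ + A₂ * u₂ + A₃ * u₃ + A₄ * u₄) - (B₁ * v₁ + B₂ * v₂)) ^ 2
        - 3 * ((A₁ ^ 2 * u₁ ^ 2 + A₂ ^ 2 * u₂ ^ 2 + A₃ ^ 2 * u₃ ^ 2 + A₄ ^ 2 * u₄ ^ 2) - (B₁ ^ 2 * v₁ ^ 2 + B₂ ^ 2 * v₂ ^ 2))
      + (3 * ((u₁ ^ 4 + u₂ ^ 4 + u₃ ^ 4 + u₄ ^ 4) - (v₁ ^ 4 + v₂ ^ 4)) - (3 / 2) * ((u₁ ^ 2 + u₂ ^ 2 + u₃ ^ 2 + u₄ ^ 2) - (v₁ ^ 2 + v₂ ^ 2)) ^ 2) := by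
  rcases le_total u₁ u₂ with o₁ | o₁
  · exact conjectureN_42_sorted2 A₁ A₂ A₃ A₄ B₁ B₂ u₁ u₂ u₃ u₄ v₁ v₂ hA hC hP1 hP2 hP4
      m₁₁ m₂₁ m₃₁ m₄₁ m₁₂ m₂₂ m₃₂ m₄₂ o₁ ov
  · exact (conjectureN_42_sorted2 A₂ A₁ A₃ A₄ B₁ B₂ u₂ u₁ u₃ u₄ v₁ v₂
      (by linarith) (by linarith) (by linarith [hP1]) (by linarith [hP2]) (by linarith [hP4])
      m₂₁ m₁₁ m₃₁ m₄₁ m₂₂ m₁₂ m₃₂ m₄₂ o₁ ov).trans_eq (by ring)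

/-- **CONJECTURE N IN FORMAT (4,2) (real charges).** Centred + pure (P1, P2, P4) + pairwise ample ⇒ `G₀ = Q₂ + Q₄ ≥ 0`. -/
theorem conjectureN_42 (A₁ A₂ A₃ A₄ B₁ B₂ u₁ u₂ u₃ u₄ v₁ v₂ : ℝ)
    (hA : A₁ + A₂ + A₃ + A₄ = B₁ + B₂) (hC : u₁ + u₂ + u₃ + u₄ = v₁ + v₂)
    (hP1 : (A₁ ^ 2 * u₁ + A₂ ^ 2 * u₂ + A₃ ^ 2 * u₃ + A₄ ^ 2 * u₄) - (B₁ ^ 2 * v₁ + B₂ ^ 2 * v₂) = 0)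
    (hP2 : (A₁ * u₁ ^ 2 + A₂ * u₂ ^ 2 + A₃ * u₃ ^ 2 + A₄ * u₄ ^ 2) - (B₁ * v₁ ^ 2 + B₂ * v₂ ^ 2) = 0)
    (hP4 : (u₁ ^ 3 + u₂ ^ 3 + u₃ ^ 3 + u₄ ^ 3) - (v₁ ^ 3 + v₂ ^ 3) = 0)
    (m₁₁ : |u₁ - v₁| ≤ A₁ - B₁) (m₂₁ : |u₂ - v₁| ≤ A₂ - B₁) (m₃₁ : |u₃ - v₁| ≤ A₃ - B₁) (m₄₁ : |u₄ - v₁| ≤ A₄ - B₁)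
    (m₁₂ : |u₁ - v₂| ≤ A₁ - B₂) (m₂₂ : |u₂ - v₂| ≤ A₂ - B₂) (m₃₂ : |u₃ - v₂| ≤ A₃ - B₂) (m₄₂ : |u₄ - v₂| ≤ A₄ - B₂) :
    0 ≤ (1 / 2) * ((A₁ ^ 2 + A₂ ^ 2 + A₃ ^ 2 + A₄ ^ 2) - (B₁ ^ 2 + B₂ ^ 2)) * ((u₁ ^ 2 + u₂ ^ 2 + u₃ ^ 2 + u₄ ^ 2) - (v₁ ^ 2 + v₂ ^ 2))
        + ((A₁ * u₁ + A₂ * u₂ + A₃ * u₃ + A₄ * u₄) - (B₁ * v₁ + B₂ * v₂)) ^ 2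
        - 3 * ((A₁ ^ 2 * u₁ ^ 2 + A₂ ^ 2 * u₂ ^ 2 + A₃ ^ 2 * u₃ ^ 2 + A₄ ^ 2 * u₄ ^ 2) - (B₁ ^ 2 * v₁ ^ 2 + B₂ ^ 2 * v₂ ^ 2))
      + (3 * ((u₁ ^ 4 + u₂ ^ 4 + u₃ ^ 4 + u₄ ^ 4) - (v₁ ^ 4 + v₂ ^ 4)) - (3 / 2) * ((u₁ ^ 2 + u₂ ^ 2 + u₃ ^ 2 + u₄ ^ 2) - (v₁ ^ 2 + v₂ ^ 2)) ^ 2) := by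
  rcases le_total v₁ v₂ with ov | ov
  · exact conjectureN_42_vsorted A₁ A₂ A₃ A₄ B₁ B₂ u₁ u₂ u₃ u₄ v₁ v₂ hA hC hP1 hP2 hP4
      m₁₁ m₂₁ m₃₁ m₄₁ m₁₂ m₂₂ m₃₂ m₄₂ ov
  · exact (conjectureN_42_vsorted A₁ A₂ A₃ A₄ B₂ B₁ u₁ u₂ u₃ u₄ v₂ v₁
      (by linarith) (by linarith) (by linarith [hP1]) (by linarith [hP2]) (by linarith [hP4])
      m₁₂ m₂₂ m₃₂ m₄₂ m₁₁ m₂₁ m₃₁ m₄₁ ov).trans_eq (by ring)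

end Summit.HodgeConjecture.HodgeConjecture.WeilClassTestFormatFourTwo
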